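import Mathlib
import Summits.AtomisticToContinuum.Crystallization.Theorems.ChargedEnergyGap.Negative.Unconditional
import Summits.AtomisticToContinuum.Crystallization.Theorems.PalmUnimodularRigidityUnimodularEnergyLowerBoundCluster
import Literature.MathematicalPhysics.StatisticalMechanics.LennardJonesClusters
import HarnessLib

/-! # Window transfer with shell thickness `a` (centre ball → particle-centred window) — stub `stub_windowTransfer` of line `Sketch` (rev. 3), crux `LjLaminarWindows` (stmt-AtomisticToContinuum-6711) -/

noncomputable section

open scoped BigOperators
open MeasureTheory Metric Filter Topology
open Literature.MathematicalPhysics.StatisticalMechanics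
open Summit.AtomisticToContinuum.Crystallization.Theorems.ChargedEnergyGapNegative

namespace Summit.AtomisticToContinuum.Crystallization.Theorems.LjLaminarWindowsSketch

/-- Row bound: summing `|v j k|` over ordered pairs `j ≠ k` with the ROW index restricted to a
predicate `p` gives at most `M · #{p}` when every row satisfies `∑_{k ≠ j} |v j k| ≤ M`. [folklore] -/
private theorem windowTransferThick_row_le {α : Type*} [Fintype α] [DecidableEq α]
    (p : α → Prop) [DecidablePred p] (v : α → α → ℝ) (M : ℝ)
    (hrow : ∀ j, ∑ k ∈ Finset.univ.erase j, |v j k| ≤ M) :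
    (∑ j, ∑ k, if j ≠ k ∧ p j then |v j k| else 0) ≤
      M * ((Finset.univ.filter p).card : ℝ) := by
  have hpt : ∀ j, (∑ k, if j ≠ k ∧ p j then |v j k| else 0) ≤ if p j then M else 0 := by
    intro j
    by_cases hj : p j
    · rw [if_pos hj]
      calc (∑ k, if j ≠ k ∧ p j then |v j k| else 0)
          = ∑ k ∈ Finset.univ.erase j, |v j k| := by
            rw [← Finset.filter_ne, Finset.sum_filter]
            exact Finset.sum_congr rfl fun k _ => if_congr (and_iff_left hj) rfl rfl
        _ ≤ M := hrow j
    · rw [if_neg hj]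
      refine (Finset.sum_eq_zero fun k _ => ?_).le
      exact if_neg fun h => hj h.2
  calc (∑ j, ∑ k, if j ≠ k ∧ p j then |v j k| else 0)
      ≤ ∑ j, (if p j then M else 0) := Finset.sum_le_sum fun j _ => hpt j
    _ = M * ((Finset.univ.filter p).card : ℝ) := by
      rw [← Finset.sum_filter, Finset.sum_const, nsmul_eq_mul]
      ring

/-- Column bound: the same as `windowTransferThick_row_le` with the COLUMN index restricted, for
a symmetric kernel `v j k = v k j`. [folklore] -/
private theorem windowTransferThick_col_le {α : Type*} [Fintype α] [DecidableEq α]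
    (p : α → Prop) [DecidablePred p] (v : α → α → ℝ) (hv : ∀ j k, v j k = v k j) (M : ℝ)
    (hrow : ∀ j, ∑ k ∈ Finset.univ.erase j, |v j k| ≤ M) :
    (∑ j, ∑ k, if j ≠ k ∧ p k then |v j k| else 0) ≤
      M * ((Finset.univ.filter p).card : ℝ) := by
  calc (∑ j, ∑ k, if j ≠ k ∧ p k then |v j k| else 0)
      = ∑ k, ∑ j, if k ≠ j ∧ p k then |v k j| else 0 := by
        refine Finset.sum_comm.trans ?_
        refine Finset.sum_congr rfl fun k _ => Finset.sum_congr rfl fun j _ => ?_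
        rw [hv j k]
        exact if_congr ⟨fun h => ⟨fun h' => h.1 h'.symm, h.2⟩, fun h => ⟨fun h' => h.1 h'.symm, h.2⟩⟩
          rfl rfl
    _ ≤ M * ((Finset.univ.filter p).card : ℝ) := windowTransferThick_row_le p v M hrow

/-- Abstract window transfer (the finite bookkeeping behind `stub_windowTransfer`): two windows
`B`, `W` whose symmetric difference lies in a shell `S`, a symmetric kernel with rows bounded by
`M`, the shell-budgeted energy bound `E(B) + λ#S ≤ 2(e+ε)#B`, the floor `2e#B ≤ E(B)` and
`λ ≥ 2M, 4ε, 4|e+ε|`, `e + ε ≤ 0 < ε` give `E(W) ≤ 2(e+2ε)#W`.  Steps: (a) `#W ≤ #B + #S`,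
`#B ≤ #W + #S`; (c) `E(W) ≤ E(B) + 2M#S` (pairs inside `W ∩ B` cancel, every other ordered pair
has an index in `W Δ B ⊆ S`, rows and — by symmetry — columns of `|v|` are bounded by `M`);
(b), (d)–(g) linear arithmetic on explicit product facts. [folklore] -/
private theorem windowTransferThick_abstract {α : Type*} [Fintype α] [DecidableEq α]
    (pB pW pS : α → Prop) [DecidablePred pB] [DecidablePred pW] [DecidablePred pS]
    (v : α → α → ℝ) (M e ε lam : ℝ)
    (hWB : ∀ j, pW j → ¬ pB j → pS j) (hBW : ∀ j, pB j → ¬ pW j → pS j)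
    (hv : ∀ j k, v j k = v k j)
    (hε : 0 < ε) (he : e + ε ≤ 0)
    (hlamM : 2 * M ≤ lam) (hlamε : 4 * ε ≤ lam) (hlame : 4 * |e + ε| ≤ lam)
    (hrow : ∀ j, ∑ k ∈ Finset.univ.erase j, |v j k| ≤ M)
    (h1 : (∑ j, ∑ k, if j ≠ k ∧ pB j ∧ pB k then v j k else 0) +
        lam * ((Finset.univ.filter pS).card : ℝ) ≤
          2 * (e + ε) * ((Finset.univ.filter pB).card : ℝ))
    (h2 : 2 * e * ((Finset.univ.filter pB).card : ℝ) ≤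
        ∑ j, ∑ k, if j ≠ k ∧ pB j ∧ pB k then v j k else 0) :
    (∑ j, ∑ k, if j ≠ k ∧ pW j ∧ pW k then v j k else 0) ≤
      2 * (e + 2 * ε) * ((Finset.univ.filter pW).card : ℝ) := by
  -- (a) the symmetric difference of the two windows lies in the shell
  have hWsub : Finset.univ.filter pW ⊆ Finset.univ.filter pB ∪ Finset.univ.filter pS := by
    intro j hj
    rw [Finset.mem_filter] at hj
    rw [Finset.mem_union, Finset.mem_filter, Finset.mem_filter]
    by_cases h : pB j
    · exact Or.inl ⟨hj.1, h⟩
    · exact Or.inr ⟨hj.1, hWB j hj.2 h⟩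
  have hBsub : Finset.univ.filter pB ⊆ Finset.univ.filter pW ∪ Finset.univ.filter pS := by
    intro j hj
    rw [Finset.mem_filter] at hj
    rw [Finset.mem_union, Finset.mem_filter, Finset.mem_filter]
    by_cases h : pW j
    · exact Or.inl ⟨hj.1, h⟩
    · exact Or.inr ⟨hj.1, hBW j hj.2 h⟩
  have ha1 : ((Finset.univ.filter pW).card : ℝ) ≤
      (Finset.univ.filter pB).card + (Finset.univ.filter pS).card := by
    exact_mod_cast (Finset.card_le_card hWsub).trans (Finset.card_union_le _ _)
  have ha2 : ((Finset.univ.filter pB).card : ℝ) ≤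
      (Finset.univ.filter pW).card + (Finset.univ.filter pS).card := by
    exact_mod_cast (Finset.card_le_card hBsub).trans (Finset.card_union_le _ _)
  -- (c) energy comparison through the shell: pairs inside `W ∩ B` cancel, every other ordered
  -- pair has an index in the symmetric difference, hence in the shell
  have hpt : ∀ j k, (if j ≠ k ∧ pW j ∧ pW k then v j k else 0) -
      (if j ≠ k ∧ pB j ∧ pB k then v j k else 0) ≤
      (if j ≠ k ∧ pS j then |v j k| else 0) + (if j ≠ k ∧ pS k then |v j k| else 0) := by
    intro j k
    have hWBj := hWB j
    have hBWj := hBW j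
    have hWBk := hWB k
    have hBWk := hBW k
    have a1 := abs_nonneg (v j k)
    have a2 := le_abs_self (v j k)
    have a3 := neg_le_abs (v j k)
    split_ifs <;> first | linarith | (exfalso; tauto)
  have hsum : (∑ j, ∑ k, if j ≠ k ∧ pW j ∧ pW k then v j k else 0) -
      (∑ j, ∑ k, if j ≠ k ∧ pB j ∧ pB k then v j k else 0) ≤
      (∑ j, ∑ k, if j ≠ k ∧ pS j then |v j k| else 0) +
        (∑ j, ∑ k, if j ≠ k ∧ pS k then |v j k| else 0) := by
    rw [← Finset.sum_sub_distrib, ← Finset.sum_add_distrib]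
    refine Finset.sum_le_sum fun j _ => ?_
    rw [← Finset.sum_sub_distrib, ← Finset.sum_add_distrib]
    exact Finset.sum_le_sum fun k _ => hpt j k
  have hr := windowTransferThick_row_le pS v M hrow
  have hc := windowTransferThick_col_le pS v hv M hrow
  -- (b), (d)-(g): arithmetic on explicit product facts
  have hnS : (0 : ℝ) ≤ ((Finset.univ.filter pS).card : ℝ) := Nat.cast_nonneg _
  have hnB : (0 : ℝ) ≤ ((Finset.univ.filter pB).card : ℝ) := Nat.cast_nonneg _
  have hnW : (0 : ℝ) ≤ ((Finset.univ.filter pW).card : ℝ) := Nat.cast_nonneg _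
  set nS : ℝ := ((Finset.univ.filter pS).card : ℝ) with hnSdef
  set nB : ℝ := ((Finset.univ.filter pB).card : ℝ) with hnBdef
  set nW : ℝ := ((Finset.univ.filter pW).card : ℝ) with hnWdef
  have p1 : 2 * M * nS ≤ lam * nS := mul_le_mul_of_nonneg_right hlamM hnS
  have p2 : (e + ε) * nB ≤ (e + ε) * (nW - nS) :=
    mul_le_mul_of_nonpos_left (by linarith) he
  have p3 : 4 * ε * nS ≤ lam * nS := mul_le_mul_of_nonneg_right hlamε hnS
  have p4 : 4 * |e + ε| * nS ≤ lam * nS := mul_le_mul_of_nonneg_right hlame hnS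
  rw [abs_of_nonpos he] at p4
  have p5 : ε * nB ≤ ε * (nW + nS) := mul_le_mul_of_nonneg_left ha2 hε.le
  linarith

/-- **Window transfer with shell thickness `a` (centre ball → particle-centred window).**
Deterministic bookkeeping: if the centre ball `B_L(c)` is energy-good with the shell budget,
`E_int(B_L(c)) + λ·#shell(c; L−a, L+a) ≤ 2(e+ε)·#B_L(c)`, its energy is floored by
`2e·#B_L(c)`, the rows of `|V|` are bounded by `M`, `λ ≥ 2M, 4ε, 4|e+ε|`, `e + ε ≤ 0 < ε`, and the
particle `i` is within `a` of `c`, then the particle-centred window `B_L(xᵢ)` (whose symmetric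
difference with `B_L(c)` lies in the shell `L - a < dist · c ≤ L + a`, by the triangle
inequality) satisfies `E_int(B_L(xᵢ)) ≤ 2(e + 2ε)·#B_L(xᵢ)`.  Here `V` is an arbitrary pair
potential evaluated at distances (so the kernel is symmetric).  (Registered stub
`stub_windowTransfer` of skeleton rev. 3, shell thickness `a`.) [folklore] -/
theorem stub_windowTransfer :
    ∀ (N : ℕ) (x : Fin N → E3) (V : ℝ → ℝ) (c : E3) (i : Fin N) (a L M e ε lam : ℝ),
      dist (x i) c ≤ a → 0 ≤ M → 0 < ε → e + ε ≤ 0 →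
      2 * M ≤ lam → 4 * ε ≤ lam → 4 * |e + ε| ≤ lam →
      (∀ j : Fin N, ∑ k ∈ Finset.univ.erase j, |V (dist (x j) (x k))| ≤ M) →
      (∑ j : Fin N, ∑ k : Fin N,
          if j ≠ k ∧ dist (x j) c ≤ L ∧ dist (x k) c ≤ L then V (dist (x j) (x k)) else 0) +
        lam * ((Finset.univ.filter fun j : Fin N => L - a < dist (x j) c ∧ dist (x j) c ≤ L + a).card : ℝ)
        ≤ 2 * (e + ε) * ((Finset.univ.filter fun j : Fin N => dist (x j) c ≤ L).card : ℝ) →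
      2 * e * ((Finset.univ.filter fun j : Fin N => dist (x j) c ≤ L).card : ℝ) ≤
        (∑ j : Fin N, ∑ k : Fin N,
          if j ≠ k ∧ dist (x j) c ≤ L ∧ dist (x k) c ≤ L then V (dist (x j) (x k)) else 0) →
      (∑ j : Fin N, ∑ k : Fin N,
          if j ≠ k ∧ dist (x j) (x i) ≤ L ∧ dist (x k) (x i) ≤ L then V (dist (x j) (x k)) else 0) ≤
        2 * (e + 2 * ε) * (Nat.card {j : Fin N // dist (x j) (x i) ≤ L} : ℝ) := by
  intro N x V c i a L M e ε lam hic _hM hε he hlamM hlamε hlame hrow h1 h2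
  have ha : 0 ≤ a := dist_nonneg.trans hic
  -- the symmetric difference of the two windows lies in the shell (triangle inequality)
  have hWB : ∀ j : Fin N, dist (x j) (x i) ≤ L → ¬ dist (x j) c ≤ L →
      L - a < dist (x j) c ∧ dist (x j) c ≤ L + a := by
    intro j hjW hjB
    have hjB' : L < dist (x j) c := not_le.mp hjB
    refine ⟨by linarith, ?_⟩
    calc dist (x j) c ≤ dist (x j) (x i) + dist (x i) c := dist_triangle _ _ _
      _ ≤ L + a := by linarith
  have hBW : ∀ j : Fin N, dist (x j) c ≤ L → ¬ dist (x j) (x i) ≤ L →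
      L - a < dist (x j) c ∧ dist (x j) c ≤ L + a := by
    intro j hjB hjW
    have hjW' : L < dist (x j) (x i) := not_le.mp hjW
    have ht : dist (x j) (x i) ≤ dist (x j) c + dist c (x i) := dist_triangle _ _ _
    rw [dist_comm c (x i)] at ht
    exact ⟨by linarith, by linarith⟩
  have hv : ∀ j k : Fin N, V (dist (x j) (x k)) = V (dist (x k) (x j)) := fun j k => by
    rw [dist_comm]
  have key := windowTransferThick_abstract (fun j => dist (x j) c ≤ L)
    (fun j => dist (x j) (x i) ≤ L) (fun j => L - a < dist (x j) c ∧ dist (x j) c ≤ L + a)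
    (fun j k => V (dist (x j) (x k))) M e ε lam hWB hBW hv hε he hlamM hlamε hlame hrow h1 h2
  have hcard : Nat.card {j : Fin N // dist (x j) (x i) ≤ L} =
      (Finset.univ.filter fun j : Fin N => dist (x j) (x i) ≤ L).card :=
    Nat.subtype_card _ fun j => by simp
  rw [hcard]
  exact key

end Summit.AtomisticToContinuum.Crystallization.Theorems.LjLaminarWindowsSketch

end
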